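import Literature.NumberTheory.EllipticCurves.GeomPointsGaloisModule
import Literature.NumberTheory.EllipticCurves.SelmerProofs
import Literature.NumberTheory.EllipticCurves.SelmerGaloisAction
import Literature.NumberTheory.EllipticCurves.DiscreteH1Equiv
import Literature.NumberTheory.EllipticCurves.SelmerTorsionInclusion
import HarnessLib

/-!
# The Kummer Selmer structure of `E[n]`: `Sel⁽ⁿ⁾(E/K)` as a Selmer group of the finite module `E[n]`

Topic `NumberTheory/EllipticCurves`. Definitions with bodies and theorems only: **no named fact is
introduced** (D-0026). Dot-notation extensions of Mathlib's `WeierstrassCurve` namespace (as in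
`Selmer.lean`, `GeomPointsGaloisModule.lean`) and one of Mathlib's `ContIntertwiningMap`.

Let `E = W` be a Weierstrass curve over a field `K`, `n : ℤ`, `E[n] = E(K̄)[n]` the finite discrete
`Γ_K`-module `W.torsionGaloisModule n` (`GeomPointsGaloisModule.lean`), and `E` a `K`-field (a
completion `K_v`) with the local module `E(K̄_E) = localPoints W E` of `Sha.lean`. The arithmetic
duality theorems that the tree states or will state for finite Galois modules — local Tate duality
(`Literature.NumberTheory.GaloisRepresentations.exists_perfectPairing_galoisCohomology_tateDual`,
proved), the Poitou–Tate vanishing `∑_v inv_v(loc_v x ∪ loc_v y) = 0`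
(`Literature.NumberTheory.GaloisCohomology.poitouTate_sum_localTatePairing_eq_zero`), Selmer
structures `DiscreteGaloisModule.SelmerStructure` and their Selmer groups
(`LocalGlobalCohomology.lean`), the isotropy of Kummer images
(`Literature.NumberTheory.EllipticCurves.kummerClass_cupProduct_kummerClass_eq_zero`) — all speak
about `H¹(K, M)`, the localisations `loc_v : H¹(K, M) → H¹(K_v, M|_{Γ_{K_v}})`
(`galoisCohomology.localization`, restriction to `Γ_{K_v}` acting on the SAME module `M`) and local
conditions `𝓛_v ≤ H¹(K_v, M|_{Γ_{K_v}})`, whereas the `n`-Selmer group `Sel⁽ⁿ⁾(E/K) = selmerGroup W n`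
and `Ш(E/K) = W.sha` of `Selmer.lean` / `Sha.lean` are cut out by the maps
`H¹(K, E[n]) → H¹(Γ_{K_v}, E(K̄_v))` into the cohomology of the local points. This file identifies
the two descriptions, with complete proofs:

* `WeierstrassCurve.kummerLocalConditionAt W n E ≤ H¹(Γ_E, E[n](K̄)|_{Γ_E})` — the **local Kummer
  condition**, the kernel of `H¹(Γ_E, E[n](K̄)) → H¹(Γ_E, E(K̄_E))` (change of coefficients along
  `E[n](K̄) ↪ E(K̄) → E(K̄_E)`, `torsionPointsMapIntertwining`); the Selmer local kernel of
  `Selmer.lean` is its preimage under restriction, `selmerLocalKer W E n = res_E⁻¹(𝓛_E)`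
  (`comap_res_kummerLocalConditionAt`).
* `WeierstrassCurve.kummerSelmerStructure W n : SelmerStructure (W.torsionGaloisModule n)` over a
  number field (`𝓛_v` = the local Kummer condition at `K_v = Place.Completion v`) and
  **`selmerGroup W n = (W.kummerSelmerStructure n).selmerGroup`**
  (`selmerGroup_eq_selmerGroup_kummerSelmerStructure`): `Sel⁽ⁿ⁾(E/K)` is the Selmer group
  `H¹_𝓛(K, E[n])` of a Selmer structure on the finite module `E[n]` in the sense of
  `LocalGlobalCohomology.lean`; hence `H¹_𝓛(K, E[n]) ↠ Ш(E/K)[n]` for `n ≠ 0`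
  (`map_torsionH1ToH1_selmerGroup_kummerSelmerStructure`, the tree's discharged Silverman X.4.2(a),
  and `exists_mem_selmerGroup_kummerSelmerStructure_of_mem_sha`).
* **The local Kummer condition is the image of the local Kummer map** (exactness of the local Kummer
  sequence `E(K_v)/n → H¹(K_v, E[n]) → H¹(K_v, E)`), for `W` elliptic, `char K = 0`, `n ≠ 0`: the
  torsion comparison `θ : E[n](K̄) ≃+ E(K̄_E)[n]` along the chosen embedding (`torsionPointsEquiv`;
  bijective since injective between groups of order `|n|²`, Silverman III.6.4(b)), the local Kummer
  class `κ_E(Q) = [σ ↦ θ⁻¹(σ • Q - Q)] ∈ H¹(Γ_E, E[n](K̄))` of `Q ∈ E(K̄_E)` with `n • Q ∈ E(E)`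
  (`localKummerCocycle`, `localKummerClass`, additive in `Q`, depending only on `n • Q`, vanishing
  iff `Q` is rational up to torsion: `localKummerClass_add`, `localKummerClass_eq_of_zsmul_eq`,
  `localKummerClass_eq_zero_iff`), and
  `c ∈ kummerLocalConditionAt W n E ↔ ∃ Q, c = κ_E(Q)`
  (`mem_kummerLocalConditionAt_iff_exists_eq_localKummerClass`); the localisation of a global
  Kummer class is the local Kummer class of the image point (`res_kummerClassTorsion`).
* **Changing the level** (the maps `A_m → A_{m²}` and `m : A_{m²} → A_m` of Milne's construction of
  the Cassels–Tate pairing, *ADT* I, proof of Prop. 6.9): the `Γ_K`-intertwining maps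
  `torsionInclusion W (h : d ∣ N) : E[d] → E[N]` and `torsionMulBy W k d : E[kd] → E[d]`, their effect
  on global Kummer classes (`map_torsionInclusion_kummerClassTorsion`,
  `map_torsionMulBy_kummerClassTorsion`) and on local ones (`map_torsionInclusion_localKummerClass`,
  `map_torsionMulBy_localKummerClass`), and the lift "`b_v ↦ b_{v,1} ∈ H¹(G_v, A_{m²})` in the image
  of `A(K_v)`" (`exists_map_torsionMulBy_localKummerClass_eq`, from the divisibility of `E(K̄_E)`).
* Generic glue (`Literature.NumberTheory.GaloisRepresentations`): the restriction
  `ContIntertwiningMap.restrictField E f` of a `Γ_K`-intertwining map to `Γ_E` and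
  `res_E ∘ H¹(f) = H¹(f|_{Γ_E}) ∘ res_E` in degree one (`galoisCohomology.res_map_one`).

Motivation: provefact `WeierstrassCurve.exists_casselsTate_pairing` (Silverman *AEC* X.4.14 =
Cassels 1962 / Tate 1962; Milne *ADT* I.6.9, 6.13(a)). Milne's definition of the pairing on
`Ш[m]` starts: "Let `a ∈ Ш(K, A)_m` … choose `b ∈ H¹(G_K, A_m)` mapping to `a` … `a` maps to zero in
`H¹(K_v, A)`, and so … we can lift `b_v` to an element `b_{v,1} ∈ H¹(G_v, A_{m²})` that is in the
image of `A(K_v)`" (p. 79) — in the tree's vocabulary: `b ∈ H¹_𝓛(K, E[m])` for the Kummer Selmer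
structure, `loc_v b = κ_v(P_v)`, `b_{v,1} = κ_v⁽ᵐ²⁾(P_v)` with `[m]_* b_{v,1} = loc_v b`; this file
supplies exactly these objects and identities, on the `DiscreteGaloisModule` side where the local
and global duality theorems live.

## References

* [SilvermanAEC2009] J. H. Silverman, *The Arithmetic of Elliptic Curves*, 2nd ed., GTM 106 (2009):
  VIII.§2 (the Kummer sequence and pairing), X.§4 (the `m`-Selmer group, diagram (**),
  Thm. X.4.2(a)), Cor. III.6.4(b) (`E[m] ≅ (ℤ/m)²`), Thm. X.4.14 (motivation).
* [MilneADT2006] J. S. Milne, *Arithmetic Duality Theorems*, 2nd ed. (2006), Ch. I §6: (6.14)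
  (`0 → A(K)/n → S(K, A)_n → Ш(K, A)_n → 0`), proof of Prop. 6.9 (pp. 78–79), Thm. 6.13.
* [SerreGaloisCohomology1997] J.-P. Serre, *Galois Cohomology* (1997), I.§2.2–2.4 (functoriality,
  compatible pairs), I.§5.1 (crossed homomorphisms), II.§1.1.
* B. Mazur, K. Rubin, *Kolyvagin systems*, Mem. AMS 799 (2004), Def. 2.1.1 (Selmer structures).
-/

noncomputable section

open scoped Classical

universe u

/-! ## Restriction of intertwining maps to `Γ_E` and its effect on `H¹` -/

namespace Literature.NumberTheory.GaloisRepresentations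

open Field
open scoped ContRepresentation

variable {K : Type u} [Field K] {M N : Type u} [AddCommGroup M] [TopologicalSpace M]
  [DiscreteTopology M] [AddCommGroup N] [TopologicalSpace N] [DiscreteTopology N]
  {ρ : DiscreteGaloisModule K M} {ρ' : DiscreteGaloisModule K N}

/-- **Restriction of a `Γ_K`-intertwining map to `Γ_E`**: a continuous `Γ_K`-equivariant map
`f : M → N` of discrete Galois modules is `Γ_E`-equivariant for the restricted modules
`M|_{Γ_E}`, `N|_{Γ_E}` (`GaloisRep.restrictField E`, `Γ_E` acting through
`absGaloisRestrict K E : Γ_E → Γ_K`); same underlying map. Deliberate dot-notation extension of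
Mathlib's `ContIntertwiningMap`. Serre, *Galois Cohomology*, I.§2.4 (compatible pairs). [folklore] -/
def _root_.ContIntertwiningMap.restrictField (E : Type u) [Field E] [Algebra K E]
    (f : ρ.toContRepresentation →ⁱL ρ'.toContRepresentation) :
    (GaloisRep.restrictField E ρ).toContRepresentation →ⁱL
      (GaloisRep.restrictField E ρ').toContRepresentation where
  toContinuousLinearMap := f.toContinuousLinearMap
  isIntertwining' σ := f.isIntertwining' (absGaloisRestrict K E σ)

/-- Unfolding `ContIntertwiningMap.restrictField`: same underlying map. [folklore] -/
@[simp]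
theorem _root_.ContIntertwiningMap.restrictField_apply (E : Type u) [Field E] [Algebra K E]
    (f : ρ.toContRepresentation →ⁱL ρ'.toContRepresentation) (m : M) :
    f.restrictField E m = f m :=
  rfl

/-- `H¹(f) [φ] = [f ∘ φ]` for the map `galoisCohomology.map f 1` on classes of continuous crossed
homomorphisms. Serre, *Galois Cohomology*, I.§2.2. [folklore] -/
theorem galoisCohomology.map_one_oneCocycleClass
    (f : ρ.toContRepresentation →ⁱL ρ'.toContRepresentation) (φ : contOneCocycles ρ.toTopRep) :
    galoisCohomology.map f 1 (oneCocycleClass ρ.toTopRep φ) =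
      oneCocycleClass ρ'.toTopRep
        (contOneCocycles.pullback (ContinuousMonoidHom.id (absoluteGaloisGroup K))
          (X := ρ.toTopRep) (Y := ρ'.toTopRep)
          (TopRep.ofHom ⟨f.toContinuousLinearMap, f.isIntertwining'⟩) φ) :=
  map_oneCocycleClass _ _ _ φ

/-- `res_E [φ] = [φ ∘ res]` for the restriction `galoisCohomology.res ρ E 1` on classes of
continuous crossed homomorphisms. Serre, *Galois Cohomology*, I.§2.4. [folklore] -/
theorem galoisCohomology.res_one_oneCocycleClass (E : Type u) [Field E] [Algebra K E]
    (φ : contOneCocycles ρ.toTopRep) :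
    galoisCohomology.res ρ E 1 (oneCocycleClass ρ.toTopRep φ) =
      oneCocycleClass (DiscreteGaloisModule.toTopRep (GaloisRep.restrictField E ρ))
        (contOneCocycles.pullback (absGaloisRestrict K E) (X := ρ.toTopRep)
          (Y := DiscreteGaloisModule.toTopRep (GaloisRep.restrictField E ρ))
          (TopRep.ofHom ⟨ContinuousLinearMap.id ℤ M, fun _ => rfl⟩) φ) :=
  map_oneCocycleClass _ _ _ φ

/-- **Restriction commutes with the change of coefficients on `H¹`**:
`res_E ∘ H¹(f) = H¹(f|_{Γ_E}) ∘ res_E : H¹(K, M) → H¹(Γ_E, N)` (both send `[φ]` to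
`[f ∘ φ ∘ res]`). Serre, *Galois Cohomology*, I.§2.4 (functoriality in compatible pairs). [folklore] -/
theorem galoisCohomology.res_map_one (E : Type u) [Field E] [Algebra K E]
    (f : ρ.toContRepresentation →ⁱL ρ'.toContRepresentation) (c : galoisCohomology ρ 1) :
    galoisCohomology.res ρ' E 1 (galoisCohomology.map f 1 c) =
      galoisCohomology.map (f.restrictField E) 1 (galoisCohomology.res ρ E 1 c) := by
  obtain ⟨φ, rfl⟩ := oneCocycleClass_surjective ρ.toTopRep c
  rw [galoisCohomology.map_one_oneCocycleClass, galoisCohomology.res_one_oneCocycleClass,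
    galoisCohomology.res_one_oneCocycleClass, galoisCohomology.map_one_oneCocycleClass]
  rfl

end Literature.NumberTheory.GaloisRepresentations

namespace WeierstrassCurve

open Literature.NumberTheory.EllipticCurves Literature.NumberTheory.GaloisRepresentations Field
open NumberField IsDedekindDomain
open scoped ContRepresentation

variable {K : Type u} [Field K] (W : WeierstrassCurve K) (n : ℤ)
variable (E : Type u) [Field E] [Algebra K E]

/-! ## The local Kummer condition at a `K`-field `E` -/

/-- The map on points `E[n](K̄) ↪ E(K̄) → E(K̄_E)` (`pointsMap` of `Sha.lean` on `E[n]`, along the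
chosen embedding `K̄ → K̄_E`) as a continuous intertwining map from the restricted module
`E[n](K̄)|_{Γ_E}` (`GaloisRep.restrictField E (W.torsionGaloisModule n)`, `Γ_E` acting through
`absGaloisRestrict K E = resGal E`) to the local module `E(K̄_E)` (`W.localGaloisModule E`);
equivariance is `pointsMap_smul`. Silverman, *AEC*, X.§4; Serre, *Galois Cohomology*, I.§2.4
(compatible pairs). [folklore] -/
def torsionPointsMapIntertwining :
    (GaloisRep.restrictField E (W.torsionGaloisModule n)).toContRepresentation →ⁱL
      (W.localGaloisModule E).toContRepresentation where
  toContinuousLinearMap :=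
    ⟨((pointsMap W E).comp (geomTorsion W n).subtype).toIntLinearMap,
      continuous_of_discreteTopology⟩
  isIntertwining' σ := by
    ext P
    change pointsMap W E (((absGaloisRestrict K E σ) • P : geomTorsion W n) : geomPoints W) =
      σ • pointsMap W E P
    rw [Literature.NumberTheory.EllipticCurves.AddSubgroup.torsionBy.coe_smul]
    exact pointsMap_smul W E σ P

/-- Unfolding `torsionPointsMapIntertwining`. [folklore] -/
@[simp]
theorem torsionPointsMapIntertwining_apply (P : geomTorsion W n) :
    W.torsionPointsMapIntertwining n E P = pointsMap W E P :=
  rfl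

/-- **The local Kummer condition of `E[n]` at the `K`-field `E`** (a completion `K_v`): the
subgroup `𝓛_E = ker (H¹(Γ_E, E[n](K̄)) → H¹(Γ_E, E(K̄_E))) ≤ H¹(Γ_E, E[n](K̄)|_{Γ_E})` of local
classes dying in the cohomology of the local points — by the local Kummer sequence, the image of
`E(E)/nE(E) → H¹(E, E[n])` (`mem_kummerLocalConditionAt_iff_exists_eq_localKummerClass`). This is the
local condition defining `Sel⁽ⁿ⁾(E/K)` (Silverman, *AEC*, X.§4: "`ker{H¹(G_v, E[m]) → H¹(G_v, E)}`
… for all `v`"; Milne, *ADT*, I.§6 (6.14)), placed on the restricted module of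
`DiscreteGaloisModule.toLocal`, where Selmer structures (`DiscreteGaloisModule.SelmerStructure`)
and the local duality theorems live. [cite: SilvermanAEC2009, X.§4 (definition of the m-Selmer group)] -/
def kummerLocalConditionAt :
    AddSubgroup (galoisCohomology (GaloisRep.restrictField E (W.torsionGaloisModule n)) 1) :=
  (galoisCohomology.map (W.torsionPointsMapIntertwining n E) 1).ker

/-- Membership in the local Kummer condition. [folklore] -/
theorem mem_kummerLocalConditionAt_iff
    (c : galoisCohomology (GaloisRep.restrictField E (W.torsionGaloisModule n)) 1) :
    c ∈ W.kummerLocalConditionAt n E ↔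
      galoisCohomology.map (W.torsionPointsMapIntertwining n E) 1 c = 0 :=
  Iff.rfl

/-- The restriction `res_E : H¹(K, E[n]) → H¹(Γ_E, E[n])` on classes of continuous crossed
homomorphisms: `[φ] ↦ [φ ∘ res]`. [folklore] -/
theorem res_torsionGaloisModule_oneCocycleClass
    (φ : contOneCocycles (discreteTopRep (absoluteGaloisGroup K) (geomTorsion W n))) :
    galoisCohomology.res (W.torsionGaloisModule n) E 1
        (oneCocycleClass (discreteTopRep (absoluteGaloisGroup K) (geomTorsion W n)) φ) =
      oneCocycleClass
        (DiscreteGaloisModule.toTopRep (GaloisRep.restrictField E (W.torsionGaloisModule n)))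
        (contOneCocycles.pullback (absGaloisRestrict K E)
          (X := discreteTopRep (absoluteGaloisGroup K) (geomTorsion W n))
          (Y := DiscreteGaloisModule.toTopRep (GaloisRep.restrictField E (W.torsionGaloisModule n)))
          (TopRep.ofHom ⟨ContinuousLinearMap.id ℤ (geomTorsion W n), fun _ => rfl⟩) φ) :=
  map_oneCocycleClass _ _ _ φ

/-- The change of coefficients `H¹(Γ_E, E[n](K̄)) → H¹(Γ_E, E(K̄_E))` on classes of continuous
crossed homomorphisms: `[ψ] ↦ [pointsMap ∘ ψ]`. [folklore] -/
theorem map_torsionPointsMapIntertwining_oneCocycleClass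
    (ψ : contOneCocycles
      (DiscreteGaloisModule.toTopRep (GaloisRep.restrictField E (W.torsionGaloisModule n)))) :
    galoisCohomology.map (W.torsionPointsMapIntertwining n E) 1 (oneCocycleClass _ ψ) =
      oneCocycleClass (discreteTopRep (absoluteGaloisGroup E) (localPoints W E))
        (contOneCocycles.pullback (ContinuousMonoidHom.id (absoluteGaloisGroup E))
          (X := DiscreteGaloisModule.toTopRep (GaloisRep.restrictField E (W.torsionGaloisModule n)))
          (Y := discreteTopRep (absoluteGaloisGroup E) (localPoints W E))
          (TopRep.ofHom ⟨(W.torsionPointsMapIntertwining n E).toContinuousLinearMap,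
            (W.torsionPointsMapIntertwining n E).isIntertwining'⟩) ψ) :=
  map_oneCocycleClass _ _ _ ψ

/-- The compatibility hypothesis of the pair `(resGal E, pointsMap ∘ (E[n] ↪ E(K̄)))` defining
`selmerLocalKer` (restated, to name the map `resH1Hom` of the pair). [folklore] -/
theorem pointsMap_comp_torsion_subtype_smul (σ : absoluteGaloisGroup E) (P : geomTorsion W n) :
    ((pointsMap W E).comp (geomTorsion W n).subtype) (resGal (K := K) E σ • P) =
      σ • ((pointsMap W E).comp (geomTorsion W n).subtype) P := by
  simp only [AddMonoidHom.coe_comp, AddSubgroup.coe_subtype, Function.comp_apply,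
    Literature.NumberTheory.EllipticCurves.AddSubgroup.torsionBy.coe_smul]
  exact pointsMap_smul W E σ P

/-- The map `H¹(K, E[n]) → H¹(Γ_E, E(K̄_E))` of the compatible pair
`(resGal E, pointsMap ∘ (E[n] ↪ E(K̄)))` (whose kernel is `selmerLocalKer W E n`) on classes of
continuous crossed homomorphisms. [folklore] -/
theorem resH1Hom_pointsMap_oneCocycleClass
    (φ : contOneCocycles (discreteTopRep (absoluteGaloisGroup K) (geomTorsion W n))) :
    resH1Hom (resGal (K := K) E) ((pointsMap W E).comp (geomTorsion W n).subtype)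
        (W.pointsMap_comp_torsion_subtype_smul n E)
        (oneCocycleClass (discreteTopRep (absoluteGaloisGroup K) (geomTorsion W n)) φ) =
      oneCocycleClass (discreteTopRep (absoluteGaloisGroup E) (localPoints W E))
        (contOneCocycles.pullback (resGal (K := K) E)
          (resHomOfEquivariant (resGal (K := K) E)
            ((pointsMap W E).comp (geomTorsion W n).subtype)
            (W.pointsMap_comp_torsion_subtype_smul n E)) φ) :=
  map_oneCocycleClass _ _ _ φ

/-- **`(pointsMap)_* ∘ res_E` is the map of the compatible pair `(resGal E, pointsMap ∘ incl)`**
on `H¹(K, E[n])` (both send `[φ]` to `[pointsMap ∘ φ ∘ res]`). [folklore] -/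
theorem map_res_torsionGaloisModule_apply (c : galH1Torsion W n) :
    galoisCohomology.map (W.torsionPointsMapIntertwining n E) 1
        (galoisCohomology.res (W.torsionGaloisModule n) E 1 c) =
      resH1Hom (resGal (K := K) E) ((pointsMap W E).comp (geomTorsion W n).subtype)
        (W.pointsMap_comp_torsion_subtype_smul n E) c := by
  obtain ⟨φ, rfl⟩ :=
    oneCocycleClass_surjective (discreteTopRep (absoluteGaloisGroup K) (geomTorsion W n)) c
  rw [res_torsionGaloisModule_oneCocycleClass, map_torsionPointsMapIntertwining_oneCocycleClass,
    resH1Hom_pointsMap_oneCocycleClass]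
  rfl

/-- **The Selmer local kernel is the preimage of the local Kummer condition under restriction**:
`selmerLocalKer W E n = res_E⁻¹ (kummerLocalConditionAt W n E)`. [folklore] -/
theorem comap_res_kummerLocalConditionAt :
    (W.kummerLocalConditionAt n E).comap (galoisCohomology.res (W.torsionGaloisModule n) E 1) =
      selmerLocalKer W E n := by
  ext c
  rw [AddSubgroup.mem_comap, mem_kummerLocalConditionAt_iff, map_res_torsionGaloisModule_apply]
  rfl

/-! ## Torsion comparison `E[n](K̄) ⥲ E(K̄_E)[n]` along the chosen embedding -/

section TorsionComparison

variable {E}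

/-- `A[n] = A[|n|]` for the `ℤ`-indexed torsion subgroups. [folklore] -/
theorem _root_.Literature.NumberTheory.EllipticCurves.torsionBy_eq_torsionBy_natAbs
    (A : Type*) [AddCommGroup A] (n : ℤ) :
    AddSubgroup.torsionBy A n = AddSubgroup.torsionBy A (n.natAbs : ℤ) := by
  ext x
  change n • x = 0 ↔ (n.natAbs : ℤ) • x = 0
  rcases Int.natAbs_eq n with h | h
  · rw [← h]
  · conv_lhs => rw [h]
    rw [neg_smul, neg_eq_zero]

/-- `#E[n] = |n|²` for an elliptic curve in characteristic `0` and `n ≠ 0` (Silverman, *AEC*,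
Cor. III.6.4(b): the tree's `card_torsionPoints_eq_sq_holds` over `K̄`). [cite: SilvermanAEC2009, Cor. III.6.4(b)] -/
theorem natCard_geomTorsion [CharZero K] [W.IsElliptic] (hn : n ≠ 0) :
    Nat.card (geomTorsion W n) = n.natAbs ^ 2 := by
  have h := card_torsionPoints_eq_sq_holds W (AlgebraicClosure K) (n := n.natAbs)
    (by exact_mod_cast Int.natAbs_ne_zero.mpr hn)
  rw [← h]
  change Nat.card (AddSubgroup.torsionBy (geomPoints W) n) =
    Nat.card (AddSubgroup.torsionBy (geomPoints W) (n.natAbs : ℤ))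
  rw [torsionBy_eq_torsionBy_natAbs]

/-- `#E(K̄_E)[n] = |n|²` likewise, over the algebraic closure of the `K`-field `E`.
[cite: SilvermanAEC2009, Cor. III.6.4(b)] -/
theorem natCard_torsionBy_localPoints [CharZero K] [W.IsElliptic] (hn : n ≠ 0) :
    Nat.card (AddSubgroup.torsionBy (localPoints W E) n) = n.natAbs ^ 2 := by
  haveI : CharZero E := charZero_of_injective_algebraMap (algebraMap K E).injective
  have h := card_torsionPoints_eq_sq_holds W (AlgebraicClosure E) (n := n.natAbs)
    (by exact_mod_cast Int.natAbs_ne_zero.mpr hn)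
  rw [← h]
  change Nat.card (AddSubgroup.torsionBy (localPoints W E) n) =
    Nat.card (AddSubgroup.torsionBy (localPoints W E) (n.natAbs : ℤ))
  rw [torsionBy_eq_torsionBy_natAbs]

/-- **`E[n](K̄) → E(K̄_E)[n]` is bijective** (`torsionPointsMap`, along the chosen embedding
`K̄ → K̄_E`) for an elliptic curve in characteristic `0` and `n ≠ 0`: it is injective and both groups
have `|n|²` elements (Silverman, *AEC*, Cor. III.6.4(b)). All the `n`-torsion of `E(K̄_E)` is
algebraic over `K`. (The tree's `Literature.NumberTheory.EllipticCurves.torsionPointsMap_bijective`,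
file `HeegnerPointsKolyvaginLocalCriterion`, is the number-field case; restated here to keep the
imports light.) [cite: SilvermanAEC2009, Cor. III.6.4(b)] -/
theorem torsionPointsMap_bijective_of_ne_zero [CharZero K] [W.IsElliptic] (hn : n ≠ 0) :
    Function.Bijective (torsionPointsMap W E n) := by
  haveI : Finite (AddSubgroup.torsionBy (localPoints W E) n) :=
    finite_torsionPoints_holds W (AlgebraicClosure E) hn
  refine (Nat.bijective_iff_injective_and_card _).mpr ⟨fun P Q h => ?_, ?_⟩
  · apply Subtype.ext
    apply pointsMapOfEmb_injective W (closureEmb (K := K) E)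
    exact congrArg (fun R : AddSubgroup.torsionBy (localPoints W E) n => (R : localPoints W E)) h
  · rw [W.natCard_geomTorsion n hn, W.natCard_torsionBy_localPoints n hn]

/-- **The torsion comparison isomorphism `E[n](K̄) ≃+ E(K̄_E)[n]`** along the chosen embedding
(`torsionPointsMap` as an `AddEquiv`), for an elliptic curve in characteristic `0` and `n ≠ 0`.
Silverman, *AEC*, Cor. III.6.4(b), VII.§3–4 (torsion is algebraic). [cite: SilvermanAEC2009, Cor. III.6.4(b)] -/
def torsionPointsEquiv [CharZero K] [W.IsElliptic] (hn : n ≠ 0) :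
    geomTorsion W n ≃+ AddSubgroup.torsionBy (localPoints W E) n :=
  AddEquiv.ofBijective (torsionPointsMap W E n) (W.torsionPointsMap_bijective_of_ne_zero n hn)

variable [CharZero K] [W.IsElliptic] (hn : n ≠ 0)

/-- Unfolding `torsionPointsEquiv`. [folklore] -/
@[simp]
theorem torsionPointsEquiv_apply (P : geomTorsion W n) :
    W.torsionPointsEquiv n (E := E) hn P = torsionPointsMap W E n P :=
  rfl

/-- The underlying point of `torsionPointsEquiv P` is `pointsMap P`. [folklore] -/
theorem coe_torsionPointsEquiv_apply (P : geomTorsion W n) :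
    ((W.torsionPointsEquiv n (E := E) hn P : AddSubgroup.torsionBy (localPoints W E) n) :
      localPoints W E) = pointsMap W E P :=
  rfl

/-- The underlying point of `P = torsionPointsEquiv⁻¹ T` maps to `T`. [folklore] -/
@[simp]
theorem pointsMap_torsionPointsEquiv_symm (T : AddSubgroup.torsionBy (localPoints W E) n) :
    pointsMap W E ((W.torsionPointsEquiv n (E := E) hn).symm T : geomTorsion W n) = T := by
  rw [← coe_torsionPointsEquiv_apply W n hn, AddEquiv.apply_symm_apply]

/-- Equivariance of `torsionPointsEquiv` along `resGal E`. [folklore] -/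
theorem torsionPointsEquiv_smul (σ : absoluteGaloisGroup E) (P : geomTorsion W n) :
    W.torsionPointsEquiv n (E := E) hn (resGal (K := K) E σ • P) =
      σ • W.torsionPointsEquiv n (E := E) hn P :=
  torsionPointsMap_smul W E n σ P

/-- Equivariance of `torsionPointsEquiv⁻¹`: `θ⁻¹ (σ • T) = res σ • θ⁻¹ T`. [folklore] -/
theorem torsionPointsEquiv_symm_smul (σ : absoluteGaloisGroup E)
    (T : AddSubgroup.torsionBy (localPoints W E) n) :
    (W.torsionPointsEquiv n (E := E) hn).symm (σ • T) =
      resGal (K := K) E σ • (W.torsionPointsEquiv n (E := E) hn).symm T := by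
  apply (W.torsionPointsEquiv n (E := E) hn).injective
  rw [AddEquiv.apply_symm_apply, torsionPointsEquiv_smul, AddEquiv.apply_symm_apply]

end TorsionComparison

/-! ## Local Kummer classes in `H¹(Γ_E, E[n](K̄))` -/

section LocalKummer

variable {E}

/-- `σ • (n • Q) = n • (σ • Q)` on `E(K̄_E)`. [folklore] -/
theorem smul_zsmul_localPoints (σ : absoluteGaloisGroup E) (Q : localPoints W E) :
    σ • (n • Q) = n • (σ • Q) :=
  map_zsmul (DistribSMul.toAddMonoidHom (localPoints W E) σ) n Q

variable {W n} in
/-- For `Q ∈ E(K̄_E)` with `n • Q` fixed by `Γ_E`, the point `σ • Q - Q` is `n`-torsion.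
Silverman, *AEC*, VIII.§2. [folklore] -/
theorem smul_sub_mem_torsionBy_localPoints {Q : localPoints W E}
    (hQ : n • Q ∈ MulAction.fixedPoints (absoluteGaloisGroup E) (localPoints W E))
    (σ : absoluteGaloisGroup E) : σ • Q - Q ∈ AddSubgroup.torsionBy (localPoints W E) n := by
  change n • (σ • Q - Q) = 0
  rw [zsmul_sub, ← smul_zsmul_localPoints, hQ σ, sub_self]

variable [CharZero K] [W.IsElliptic] (hn : n ≠ 0)

/-- **The local Kummer cocycle** of a point `Q ∈ E(K̄_E)` with `n • Q ∈ E(K̄_E)^{Γ_E} = E(E)`: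
`σ ↦ θ⁻¹ (σ • Q - Q)`, a continuous crossed homomorphism `Γ_E → E[n](K̄)` for the restricted
action (`θ = torsionPointsEquiv`, the torsion comparison). Silverman, *AEC*, VIII.§2 (`δ`) and
X.§4 (the local Kummer sequences in diagram (**)); Milne, *ADT*, I.§6, proof of Prop. 6.9
("`b_v = δ_v(P_v)`, `P_v ∈ A(K_v)`"). [folklore] -/
def localKummerCocycle (Q : localPoints W E)
    (hQ : n • Q ∈ MulAction.fixedPoints (absoluteGaloisGroup E) (localPoints W E)) :
    contOneCocycles
      (DiscreteGaloisModule.toTopRep (GaloisRep.restrictField E (W.torsionGaloisModule n))) :=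
  ⟨⟨fun σ => (W.torsionPointsEquiv n (E := E) hn).symm
      ⟨σ • Q - Q, smul_sub_mem_torsionBy_localPoints hQ σ⟩,
    continuous_of_discreteTopology.comp
      (((continuous_smul_of_isOpen_stabilizer Q (W.isOpen_stabilizer_localPoints E Q)).sub
        continuous_const).subtype_mk _)⟩,
    fun g h => by
      change (W.torsionPointsEquiv n (E := E) hn).symm ⟨(g * h) • Q - Q, _⟩ =
        (W.torsionPointsEquiv n (E := E) hn).symm ⟨g • Q - Q, _⟩ +
          absGaloisRestrict K E g • (W.torsionPointsEquiv n (E := E) hn).symm ⟨h • Q - Q, _⟩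
      rw [← resGal_eq_absGaloisRestrict, ← torsionPointsEquiv_symm_smul, ← map_add]
      congr 1
      apply Subtype.ext
      change (g * h) • Q - Q = (g • Q - Q) + g • (h • Q - Q)
      rw [mul_smul, smul_sub]
      abel⟩

/-- Values of the local Kummer cocycle, on underlying points: `pointsMap (κ_Q σ) = σ • Q - Q`.
[folklore] -/
@[simp]
theorem pointsMap_localKummerCocycle_apply (Q : localPoints W E)
    (hQ : n • Q ∈ MulAction.fixedPoints (absoluteGaloisGroup E) (localPoints W E))
    (σ : absoluteGaloisGroup E) :
    pointsMap W E ((W.localKummerCocycle n hn Q hQ).1 σ : geomTorsion W n) = σ • Q - Q :=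
  W.pointsMap_torsionPointsEquiv_symm n hn _

/-- **The local Kummer class** `κ_E(Q) = [σ ↦ θ⁻¹(σ • Q - Q)] ∈ H¹(Γ_E, E[n](K̄))` of a point
`Q ∈ E(K̄_E)` with `n • Q ∈ E(E)`: the image of `n • Q ∈ E(E) = E(K̄_E)^{Γ_E}` under the local
Kummer map `E(E)/nE(E) → H¹(E, E[n])`, read in the coefficients `E[n](K̄)|_{Γ_E}` of the
restricted module (the local module of `DiscreteGaloisModule.toLocal`). Silverman, *AEC*, VIII.§2,
X.§4; Milne, *ADT*, I.§6. [folklore] -/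
def localKummerClass (Q : localPoints W E)
    (hQ : n • Q ∈ MulAction.fixedPoints (absoluteGaloisGroup E) (localPoints W E)) :
    galoisCohomology (GaloisRep.restrictField E (W.torsionGaloisModule n)) 1 :=
  oneCocycleClass _ (W.localKummerCocycle n hn Q hQ)

/-- **Local Kummer classes satisfy the local Kummer condition**: `κ_E(Q)` dies in
`H¹(Γ_E, E(K̄_E))` (its image is the class of the coboundary of `Q`). Silverman, *AEC*, X.§4
(commutativity of (**)); Milne, *ADT*, I.§6 (6.14). [folklore] -/
theorem localKummerClass_mem_kummerLocalConditionAt (Q : localPoints W E)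
    (hQ : n • Q ∈ MulAction.fixedPoints (absoluteGaloisGroup E) (localPoints W E)) :
    W.localKummerClass n hn Q hQ ∈ W.kummerLocalConditionAt n E := by
  rw [mem_kummerLocalConditionAt_iff, localKummerClass,
    map_torsionPointsMapIntertwining_oneCocycleClass]
  exact (oneCocycleClass_eq_zero_iff _ _).mpr
    ⟨Q, fun σ => W.pointsMap_localKummerCocycle_apply n hn Q hQ σ⟩

/-- **Exactness of the local Kummer sequence at `H¹(E, E[n])`**: a class of `H¹(Γ_E, E[n](K̄))`
satisfying the local Kummer condition (dying in `H¹(Γ_E, E(K̄_E))`) is the local Kummer class of a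
point `Q ∈ E(K̄_E)` with `n • Q ∈ E(E)`. Silverman, *AEC*, VIII.§2 and X.§4 (exactness of the
local Kummer sequence `0 → E(K_v)/mE(K_v) → H¹(K_v, E[m]) → H¹(K_v, E)[m] → 0`); Milne, *ADT*,
I.§6, proof of Prop. 6.9. [cite: SilvermanAEC2009, X.§4 diagram (**)] -/
theorem exists_eq_localKummerClass_of_mem
    {c : galoisCohomology (GaloisRep.restrictField E (W.torsionGaloisModule n)) 1}
    (hc : c ∈ W.kummerLocalConditionAt n E) :
    ∃ (Q : localPoints W E)
      (hQ : n • Q ∈ MulAction.fixedPoints (absoluteGaloisGroup E) (localPoints W E)),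
      c = W.localKummerClass n hn Q hQ := by
  obtain ⟨ψ, rfl⟩ := oneCocycleClass_surjective _ c
  rw [mem_kummerLocalConditionAt_iff, map_torsionPointsMapIntertwining_oneCocycleClass] at hc
  obtain ⟨Q, hQ⟩ := (oneCocycleClass_eq_zero_iff _ _).mp hc
  have hQ' : ∀ σ : absoluteGaloisGroup E, pointsMap W E (ψ.1 σ : geomTorsion W n) = σ • Q - Q :=
    hQ
  have hfix : n • Q ∈ MulAction.fixedPoints (absoluteGaloisGroup E) (localPoints W E) := by
    intro σ
    have h0 : n • (σ • Q - Q) = 0 := by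
      rw [← hQ' σ, ← map_zsmul]
      have : n • ((ψ.1 σ : geomTorsion W n) : geomPoints W) = 0 :=
        (mem_geomTorsion_iff W n _).mp (ψ.1 σ).2
      rw [this, map_zero]
    rw [zsmul_sub, ← smul_zsmul_localPoints, sub_eq_zero] at h0
    exact h0
  refine ⟨Q, hfix, congrArg (oneCocycleClass _) (Subtype.ext (ContinuousMap.ext fun σ => ?_))⟩
  apply (W.torsionPointsEquiv n (E := E) hn).injective
  apply Subtype.ext
  change pointsMap W E (ψ.1 σ : geomTorsion W n) =
    ((W.torsionPointsEquiv n (E := E) hn) ((W.torsionPointsEquiv n (E := E) hn).symm _) :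
      localPoints W E)
  rw [AddEquiv.apply_symm_apply]
  exact hQ' σ

/-- **The local Kummer condition is the image of the local Kummer map**: membership in
`kummerLocalConditionAt W n E` is being a local Kummer class. Silverman, *AEC*, X.§4;
Milne, *ADT*, I.§6. [folklore] -/
theorem mem_kummerLocalConditionAt_iff_exists_eq_localKummerClass
    (c : galoisCohomology (GaloisRep.restrictField E (W.torsionGaloisModule n)) 1) :
    c ∈ W.kummerLocalConditionAt n E ↔
      ∃ (Q : localPoints W E)
        (hQ : n • Q ∈ MulAction.fixedPoints (absoluteGaloisGroup E) (localPoints W E)),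
        c = W.localKummerClass n hn Q hQ :=
  ⟨W.exists_eq_localKummerClass_of_mem n hn, by
    rintro ⟨Q, hQ, rfl⟩
    exact W.localKummerClass_mem_kummerLocalConditionAt n hn Q hQ⟩

/-- Additivity of the local Kummer cocycle in `Q`. [folklore] -/
theorem localKummerCocycle_add (Q Q' : localPoints W E)
    (hQ : n • Q ∈ MulAction.fixedPoints (absoluteGaloisGroup E) (localPoints W E))
    (hQ' : n • Q' ∈ MulAction.fixedPoints (absoluteGaloisGroup E) (localPoints W E))
    (hQQ' : n • (Q + Q') ∈ MulAction.fixedPoints (absoluteGaloisGroup E) (localPoints W E)) :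
    W.localKummerCocycle n hn (Q + Q') hQQ' =
      W.localKummerCocycle n hn Q hQ + W.localKummerCocycle n hn Q' hQ' := by
  apply Subtype.ext
  ext σ : 1
  change (W.torsionPointsEquiv n (E := E) hn).symm _ =
    (W.torsionPointsEquiv n (E := E) hn).symm _ + (W.torsionPointsEquiv n (E := E) hn).symm _
  rw [← map_add]
  congr 1
  apply Subtype.ext
  change σ • (Q + Q') - (Q + Q') = (σ • Q - Q) + (σ • Q' - Q')
  rw [smul_add]
  abel

/-- Additivity of the local Kummer class in `Q`. Silverman, *AEC*, VIII.§2 (`δ` is a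
homomorphism). [folklore] -/
theorem localKummerClass_add (Q Q' : localPoints W E)
    (hQ : n • Q ∈ MulAction.fixedPoints (absoluteGaloisGroup E) (localPoints W E))
    (hQ' : n • Q' ∈ MulAction.fixedPoints (absoluteGaloisGroup E) (localPoints W E))
    (hQQ' : n • (Q + Q') ∈ MulAction.fixedPoints (absoluteGaloisGroup E) (localPoints W E)) :
    W.localKummerClass n hn (Q + Q') hQQ' =
      W.localKummerClass n hn Q hQ + W.localKummerClass n hn Q' hQ' := by
  unfold localKummerClass
  rw [localKummerCocycle_add W n hn Q Q' hQ hQ', oneCocycleClass_add]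
  rfl

variable {W n hn} in
/-- Local Kummer classes of equal points are equal (proof-irrelevance helper). [folklore] -/
theorem localKummerClass_congr {Q Q' : localPoints W E}
    {hQ : n • Q ∈ MulAction.fixedPoints (absoluteGaloisGroup E) (localPoints W E)}
    {hQ' : n • Q' ∈ MulAction.fixedPoints (absoluteGaloisGroup E) (localPoints W E)}
    (h : Q = Q') : W.localKummerClass n hn Q hQ = W.localKummerClass n hn Q' hQ' := by
  subst h; rfl

/-- The local Kummer class vanishes iff `Q` is `Γ_E`-fixed up to an `n`-torsion point
(exactness of the local Kummer sequence at `E(E)/nE(E)`). Silverman, *AEC*, VIII.§2. [folklore] -/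
theorem localKummerClass_eq_zero_iff (Q : localPoints W E)
    (hQ : n • Q ∈ MulAction.fixedPoints (absoluteGaloisGroup E) (localPoints W E)) :
    W.localKummerClass n hn Q hQ = 0 ↔ ∃ T ∈ AddSubgroup.torsionBy (localPoints W E) n,
      Q - T ∈ MulAction.fixedPoints (absoluteGaloisGroup E) (localPoints W E) := by
  refine (oneCocycleClass_eq_zero_iff _ (W.localKummerCocycle n hn Q hQ)).trans ?_
  constructor
  · rintro ⟨v, hv⟩
    refine ⟨pointsMap W E (v : geomTorsion W n), ?_, fun σ => ?_⟩
    · change n • pointsMap W E ((v : geomTorsion W n) : geomPoints W) = 0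
      rw [← map_zsmul, (mem_geomTorsion_iff W n _).mp v.2, map_zero]
    · have h2 := W.pointsMap_localKummerCocycle_apply n hn Q hQ σ
      rw [hv σ] at h2
      have h3 : pointsMap W E (((absGaloisRestrict K E σ • v : geomTorsion W n) : geomPoints W) -
          v) = σ • Q - Q := h2
      rw [map_sub, Literature.NumberTheory.EllipticCurves.AddSubgroup.torsionBy.coe_smul,
        ← resGal_eq_absGaloisRestrict, pointsMap_smul] at h3
      rw [smul_sub, sub_eq_sub_iff_sub_eq_sub, h3]
  · rintro ⟨T, hT, hfix⟩
    refine ⟨(W.torsionPointsEquiv n (E := E) hn).symm ⟨T, hT⟩, fun σ => ?_⟩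
    apply (W.torsionPointsEquiv n (E := E) hn).injective
    apply Subtype.ext
    change pointsMap W E ((W.localKummerCocycle n hn Q hQ).1 σ : geomTorsion W n) =
      pointsMap W E (((absGaloisRestrict K E σ •
        (W.torsionPointsEquiv n (E := E) hn).symm ⟨T, hT⟩ : geomTorsion W n) : geomPoints W) -
          (W.torsionPointsEquiv n (E := E) hn).symm ⟨T, hT⟩)
    rw [pointsMap_localKummerCocycle_apply, map_sub,
      Literature.NumberTheory.EllipticCurves.AddSubgroup.torsionBy.coe_smul,
      ← resGal_eq_absGaloisRestrict, pointsMap_smul, pointsMap_torsionPointsEquiv_symm]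
    have h := hfix σ
    rw [smul_sub, sub_eq_sub_iff_sub_eq_sub] at h
    exact h

/-- The local Kummer class of `Q` depends only on `n • Q` (it is a function on `E(E)`).
Silverman, *AEC*, VIII.§2. [folklore] -/
theorem localKummerClass_eq_of_zsmul_eq (Q Q' : localPoints W E)
    (hQ : n • Q ∈ MulAction.fixedPoints (absoluteGaloisGroup E) (localPoints W E))
    (hQ' : n • Q' ∈ MulAction.fixedPoints (absoluteGaloisGroup E) (localPoints W E))
    (h : n • Q = n • Q') : W.localKummerClass n hn Q hQ = W.localKummerClass n hn Q' hQ' := by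
  have hT : Q' - Q ∈ AddSubgroup.torsionBy (localPoints W E) n := by
    change n • (Q' - Q) = 0
    rw [zsmul_sub, h, sub_self]
  have hT' : n • (Q' - Q) ∈ MulAction.fixedPoints (absoluteGaloisGroup E) (localPoints W E) := by
    have h0 : n • (Q' - Q) = 0 := hT
    rw [h0]
    exact fun σ => smul_zero σ
  have hsum : n • (Q + (Q' - Q)) ∈
      MulAction.fixedPoints (absoluteGaloisGroup E) (localPoints W E) := by
    rw [add_sub_cancel]; exact hQ'
  have hzero : W.localKummerClass n hn (Q' - Q) hT' = 0 :=
    (W.localKummerClass_eq_zero_iff n hn _ hT').mpr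
      ⟨Q' - Q, hT, by rw [sub_self]; exact fun σ => smul_zero σ⟩
  rw [localKummerClass_congr (hQ := hQ') (hQ' := hsum) (add_sub_cancel Q Q').symm,
    W.localKummerClass_add n hn Q (Q' - Q) hQ hT' hsum, hzero, add_zero]

/-- **Localisation of global Kummer classes**: the restriction to `Γ_E` of the Kummer class
`[σ ↦ σ • Q - Q] ∈ H¹(K, E[n])` of `Q ∈ E(K̄)` (`kummerClassTorsion`) is the local Kummer class of
its image `pointsMap Q ∈ E(K̄_E)`. Silverman, *AEC*, X.§4 (commutativity of the left square of
(**)); Milne, *ADT*, I.§6. [folklore] -/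
theorem res_kummerClassTorsion (Q : geomPoints W)
    (hQ : n • Q ∈ MulAction.fixedPoints (absoluteGaloisGroup K) (geomPoints W))
    (hQ' : n • pointsMap W E Q ∈ MulAction.fixedPoints (absoluteGaloisGroup E) (localPoints W E)) :
    galoisCohomology.res (W.torsionGaloisModule n) E 1 (kummerClassTorsion W n Q hQ) =
      W.localKummerClass n hn (pointsMap W E Q) hQ' := by
  unfold kummerClassTorsion localKummerClass
  rw [res_torsionGaloisModule_oneCocycleClass]
  congr 1
  apply Subtype.ext
  ext σ : 1
  apply (W.torsionPointsEquiv n (E := E) hn).injective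
  apply Subtype.ext
  rw [contOneCocycles.pullback_apply]
  change pointsMap W E ((kummerCocycleTorsion W n Q hQ).1 (absGaloisRestrict K E σ) : geomPoints W) =
    pointsMap W E ((W.localKummerCocycle n hn (pointsMap W E Q) hQ').1 σ : geomTorsion W n)
  rw [pointsMap_localKummerCocycle_apply, coe_kummerCocycleTorsion_apply, map_sub,
    ← resGal_eq_absGaloisRestrict, pointsMap_smul]

omit [CharZero K] [W.IsElliptic] in
/-- The image of a `Γ_K`-fixed multiple is `Γ_E`-fixed: if `n • Q ∈ E(K̄)^{Γ_K}` then
`n • pointsMap Q ∈ E(K̄_E)^{Γ_E}`. [folklore] -/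
theorem zsmul_pointsMap_mem_fixedPoints (Q : geomPoints W)
    (hQ : n • Q ∈ MulAction.fixedPoints (absoluteGaloisGroup K) (geomPoints W)) :
    n • pointsMap W E Q ∈ MulAction.fixedPoints (absoluteGaloisGroup E) (localPoints W E) := by
  intro σ
  rw [← map_zsmul, ← pointsMap_smul, hQ (resGal (K := K) E σ)]

end LocalKummer

/-! ## The Kummer Selmer structure of `E[n]` over a number field -/

section NumberField

variable [NumberField K]

/-- **The Kummer Selmer structure of `E[n]`**: the Selmer structure
(`DiscreteGaloisModule.SelmerStructure`, Mazur–Rubin Def. 2.1.1) on the finite discrete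
`Γ_K`-module `E[n] = W.torsionGaloisModule n` whose local condition at the place `v` is the local
Kummer condition `ker (H¹(K_v, E[n]) → H¹(K_v, E(K̄_v)))` (`kummerLocalConditionAt` at the
completion `K_v = Place.Completion v`), i.e. (by the local Kummer sequence) the image of
`E(K_v)/nE(K_v) → H¹(K_v, E[n])`. Its Selmer group is `Sel⁽ⁿ⁾(E/K)`
(`selmerGroup_eq_selmerGroup_kummerSelmerStructure`). Silverman, *AEC*, X.§4 (definition of
`S⁽ᵐ⁾(E/K)`); Milne, *ADT*, I.§6 (6.14); Mazur–Rubin, *Kolyvagin systems*, Def. 2.1.1.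
[cite: SilvermanAEC2009, X.§4 (definition of the m-Selmer group)] -/
def kummerSelmerStructure : DiscreteGaloisModule.SelmerStructure (W.torsionGaloisModule n) :=
  fun v => W.kummerLocalConditionAt n (Place.Completion v)

/-- Unfolding `kummerSelmerStructure` at a place. [folklore] -/
@[simp]
theorem kummerSelmerStructure_apply (v : Place K) :
    W.kummerSelmerStructure n v = W.kummerLocalConditionAt n (Place.Completion v) :=
  rfl

/-- At a finite place `v`, the Selmer local kernel at `Place.Completion (Sum.inr v)` is the one at
`v.adicCompletion K` (definitional, by cases on `Place`). [folklore] -/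
theorem selmerLocalKer_completion_inr (v : HeightOneSpectrum (𝓞 K)) :
    selmerLocalKer W (Place.Completion (Sum.inr v : Place K)) n =
      selmerLocalKer W (v.adicCompletion K) n :=
  rfl

/-- At an infinite place `w`, the Selmer local kernel at `Place.Completion (Sum.inl w)` is the one
at `w.Completion` (definitional). [folklore] -/
theorem selmerLocalKer_completion_inl (w : InfinitePlace K) :
    selmerLocalKer W (Place.Completion (Sum.inl w : Place K)) n = selmerLocalKer W w.Completion n :=
  rfl

/-- The local condition of the Kummer Selmer structure pulled back to `H¹(K, E[n])` is the Selmer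
local kernel of `Selmer.lean` at the completion. [folklore] -/
theorem comap_localization_kummerSelmerStructure (v : Place K) :
    (W.kummerSelmerStructure n v).comap
        (galoisCohomology.localization (W.torsionGaloisModule n) v 1) =
      selmerLocalKer W (Place.Completion v) n :=
  W.comap_res_kummerLocalConditionAt n (Place.Completion v)

/-- **`Sel⁽ⁿ⁾(E/K)` is the Selmer group of the Kummer Selmer structure on `E[n]`**: the `n`-Selmer
group of `Selmer.lean` (classes of `H¹(K, E[n])` dying in `H¹(K_v, E)` at every finite and every
infinite place) is the Selmer group `H¹_𝓛(K, E[n]) = {c | loc_v c ∈ 𝓛_v for all v}`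
(`DiscreteGaloisModule.SelmerStructure.selmerGroup`) of `𝓛 = kummerSelmerStructure W n`, as
subgroups of the same group `H¹(K, E[n])`. Silverman, *AEC*, X.§4; Milne, *ADT*, I.§6 (6.14);
Mazur–Rubin, *Kolyvagin systems*, Def. 2.1.1. [folklore] -/
theorem selmerGroup_eq_selmerGroup_kummerSelmerStructure :
    selmerGroup W n = (W.kummerSelmerStructure n).selmerGroup := by
  ext c
  refine (mem_selmerGroup_iff W n c).trans
    (Iff.trans ?_ ((W.kummerSelmerStructure n).mem_selmerGroup_iff c).symm)
  rw [Sum.forall, and_comm]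
  refine and_congr (forall_congr' fun w => ?_) (forall_congr' fun v => ?_)
  · exact (SetLike.ext_iff.mp (W.comap_localization_kummerSelmerStructure n (Sum.inl w)) c).symm
  · exact (SetLike.ext_iff.mp (W.comap_localization_kummerSelmerStructure n (Sum.inr v)) c).symm

/-- Membership in `Sel⁽ⁿ⁾(E/K)` in terms of the Kummer Selmer structure: `c ∈ Sel⁽ⁿ⁾(E/K)` iff
`loc_v c` satisfies the local Kummer condition at every place `v`. [folklore] -/
theorem mem_selmerGroup_iff_forall_localization_mem (c : galH1Torsion W n) :
    c ∈ selmerGroup W n ↔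
      ∀ v : Place K, galoisCohomology.localization (W.torsionGaloisModule n) v 1 c ∈
        W.kummerSelmerStructure n v :=
  (SetLike.ext_iff.mp (W.selmerGroup_eq_selmerGroup_kummerSelmerStructure n) c).trans
    ((W.kummerSelmerStructure n).mem_selmerGroup_iff c)

/-- **`H¹_𝓛(K, E[n]) ↠ Ш(E/K)[n]` for the Kummer Selmer structure** (Silverman, *AEC*,
Thm. X.4.2(a); Milne, *ADT*, I.§6 (6.14)): for `n ≠ 0` the image of the Selmer group of
`kummerSelmerStructure W n` under `H¹(K, E[n]) → H¹(K, E)` is `Ш(E/K) ∩ H¹(K, E)[n]`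
(the tree's discharged `map_torsionH1ToH1_selmerGroup_holds`, transported).
[cite: SilvermanAEC2009, Thm X.4.2(a)] -/
theorem map_torsionH1ToH1_selmerGroup_kummerSelmerStructure (hn : n ≠ 0) :
    ((W.kummerSelmerStructure n).selmerGroup).map (torsionH1ToH1 W n) =
      W.sha ⊓ AddSubgroup.torsionBy W.galH1 n := by
  rw [← selmerGroup_eq_selmerGroup_kummerSelmerStructure]
  exact map_torsionH1ToH1_selmerGroup_holds W hn

/-- Every `a ∈ Ш(E/K)` with `n • a = 0` (`n ≠ 0`) lifts to the Selmer group of the Kummer Selmer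
structure on `E[n]`: `a = ι_* b` with `loc_v b` in the local Kummer condition at every place.
Silverman, *AEC*, Thm. X.4.2(a); Milne, *ADT*, I.§6, proof of Prop. 6.9 ("choose `b ∈ H¹(G_K, A_m)`
mapping to `a`"). [cite: SilvermanAEC2009, Thm X.4.2(a)] -/
theorem exists_mem_selmerGroup_kummerSelmerStructure_of_mem_sha (hn : n ≠ 0) {a : W.galH1}
    (ha : a ∈ W.sha) (hna : n • a = 0) :
    ∃ b ∈ (W.kummerSelmerStructure n).selmerGroup, torsionH1ToH1 W n b = a := by
  have h : a ∈ ((W.kummerSelmerStructure n).selmerGroup).map (torsionH1ToH1 W n) := by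
    rw [map_torsionH1ToH1_selmerGroup_kummerSelmerStructure W n hn]
    exact ⟨ha, hna⟩
  exact h

end NumberField

/-! ## Changing the level: `E[d] ↪ E[N]` (`d ∣ N`) and `[k] : E[kd] → E[d]` on Kummer classes -/

section Levels

variable {n}

/-- **The inclusion `E[d] ↪ E[N]` for `d ∣ N`** as a continuous `Γ_K`-intertwining map of the
discrete Galois modules `torsionGaloisModule` (the map `A_m → A_{m²}` of Milne, *ADT*, I.§6,
proof of Prop. 6.9, for `N = d²`). [folklore] -/
def torsionInclusion {d N : ℤ} (h : d ∣ N) :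
    (W.torsionGaloisModule d).toContRepresentation →ⁱL
      (W.torsionGaloisModule N).toContRepresentation where
  toContinuousLinearMap :=
    ⟨(AddSubgroup.inclusion (W.geomTorsion_le_of_dvd h)).toIntLinearMap,
      continuous_of_discreteTopology⟩
  isIntertwining' σ := by
    ext P
    rfl

/-- Unfolding `torsionInclusion` on underlying points. [folklore] -/
@[simp]
theorem coe_torsionInclusion_apply {d N : ℤ} (h : d ∣ N) (P : geomTorsion W d) :
    ((W.torsionInclusion h P : geomTorsion W N) : geomPoints W) = P :=
  rfl

/-- On `H¹(K, E[d])`, the map `H¹(torsionInclusion h)` of the `GaloisRepresentations` library **is**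
the change-of-level map `torsionH1OfDvd W h : H¹(K, E[d]) → H¹(K, E[N])` of
`SelmerTorsionInclusion.lean` (both are Mathlib's `ContinuousCohomology.map` along
`(id, E[d] ↪ E[N])`; definitional). [folklore] -/
theorem map_torsionInclusion_one_apply {d N : ℤ} (h : d ∣ N) (c : galH1Torsion W d) :
    galoisCohomology.map (W.torsionInclusion h) 1 c = torsionH1OfDvd W h c :=
  rfl

/-- `k • P ∈ E[d]` for `P ∈ E[kd]`. [folklore] -/
theorem zsmul_mem_geomTorsion_of_mem (k d : ℤ) {P : geomPoints W} (hP : P ∈ geomTorsion W (k * d)) :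
    k • P ∈ geomTorsion W d := by
  rw [mem_geomTorsion_iff] at hP ⊢
  rw [smul_smul, mul_comm, hP]

/-- **Multiplication by `k`, `E[kd] → E[d]`** as a continuous `Γ_K`-intertwining map of the discrete
Galois modules `torsionGaloisModule` (the map `m : A_{m²} → A_m` of Milne, *ADT*, I.§6, proof of
Prop. 6.9, for `k = d = m`). [folklore] -/
def torsionMulBy (k d : ℤ) :
    (W.torsionGaloisModule (k * d)).toContRepresentation →ⁱL
      (W.torsionGaloisModule d).toContRepresentation where
  toContinuousLinearMap :=
    ⟨((zsmulAddGroupHom (α := geomPoints W) k).comp (geomTorsion W (k * d)).subtype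
        |>.codRestrict (geomTorsion W d) fun P =>
          W.zsmul_mem_geomTorsion_of_mem k d P.2).toIntLinearMap,
      continuous_of_discreteTopology⟩
  isIntertwining' σ := by
    ext P
    change k • ((σ • P : geomTorsion W (k * d)) : geomPoints W) =
      σ • (k • (P : geomPoints W))
    rw [Literature.NumberTheory.EllipticCurves.AddSubgroup.torsionBy.coe_smul,
      smul_zsmul_geomPoints]

/-- Unfolding `torsionMulBy` on underlying points: `P ↦ k • P`. [folklore] -/
@[simp]
theorem coe_torsionMulBy_apply (k d : ℤ) (P : geomTorsion W (k * d)) :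
    ((W.torsionMulBy k d P : geomTorsion W d) : geomPoints W) = k • (P : geomPoints W) :=
  rfl

/-- `[k] ∘ (E[d] ↪ E[kd]) = k` on `E[d]`: the composite of the inclusion and the multiplication is
multiplication by `k` (on underlying points). [folklore] -/
theorem coe_torsionMulBy_torsionInclusion (k d : ℤ) (P : geomTorsion W d) :
    ((W.torsionMulBy k d (W.torsionInclusion (Dvd.intro_left k rfl) P) : geomTorsion W d) :
      geomPoints W) = k • (P : geomPoints W) :=
  rfl

/-- A `Γ_K`-fixed multiple `d • Q` gives a `Γ_K`-fixed multiple `N • Q` for `d ∣ N`. [folklore] -/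
theorem zsmul_mem_fixedPoints_of_dvd {d N : ℤ} (h : d ∣ N) {Q : geomPoints W}
    (hQ : d • Q ∈ MulAction.fixedPoints (absoluteGaloisGroup K) (geomPoints W)) :
    N • Q ∈ MulAction.fixedPoints (absoluteGaloisGroup K) (geomPoints W) := by
  obtain ⟨e, rfl⟩ := h
  intro σ
  rw [mul_comm, mul_zsmul, smul_zsmul_geomPoints, hQ σ]

/-- **Kummer classes under `E[d] ↪ E[N]`**: the image of the level-`d` Kummer class of `Q`
(`d • Q ∈ E(K)`) is the level-`N` Kummer class of the same `Q` — on `E(K)`,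
`ι_* ∘ δ_d = δ_N ∘ [N/d]`. (Same cocycle `σ ↦ σ • Q - Q`.) Silverman, *AEC*, VIII.§2;
Milne, *ADT*, I.§6, proof of Prop. 6.9. [folklore] -/
theorem map_torsionInclusion_kummerClassTorsion {d N : ℤ} (h : d ∣ N) (Q : geomPoints W)
    (hQ : d • Q ∈ MulAction.fixedPoints (absoluteGaloisGroup K) (geomPoints W))
    (hQ' : N • Q ∈ MulAction.fixedPoints (absoluteGaloisGroup K) (geomPoints W)) :
    galoisCohomology.map (W.torsionInclusion h) 1 (kummerClassTorsion W d Q hQ) =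
      kummerClassTorsion W N Q hQ' := by
  unfold kummerClassTorsion
  refine (galoisCohomology.map_one_oneCocycleClass (W.torsionInclusion h)
    (kummerCocycleTorsion W d Q hQ)).trans ?_
  congr 1

/-- **Kummer classes under `[k] : E[kd] → E[d]`**: the image of the level-`kd` Kummer class of `Q`
(`kd • Q ∈ E(K)`) is the level-`d` Kummer class of `k • Q` — on `E(K)`, `[k]_* ∘ δ_{kd} = δ_d`
("`b_{v,1}` maps to `b_v`", Milne, *ADT*, I.§6, proof of Prop. 6.9). Silverman, *AEC*, VIII.§2.
[folklore] -/
theorem map_torsionMulBy_kummerClassTorsion (k d : ℤ) (Q : geomPoints W)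
    (hQ : (k * d) • Q ∈ MulAction.fixedPoints (absoluteGaloisGroup K) (geomPoints W))
    (hQ' : d • (k • Q) ∈ MulAction.fixedPoints (absoluteGaloisGroup K) (geomPoints W)) :
    galoisCohomology.map (W.torsionMulBy k d) 1 (kummerClassTorsion W (k * d) Q hQ) =
      kummerClassTorsion W d (k • Q) hQ' := by
  unfold kummerClassTorsion
  refine (galoisCohomology.map_one_oneCocycleClass (W.torsionMulBy k d)
    (kummerCocycleTorsion W (k * d) Q hQ)).trans ?_
  congr 1
  apply Subtype.ext
  ext σ : 1
  apply Subtype.ext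
  change k • (σ • Q - Q) = σ • (k • Q) - k • Q
  rw [zsmul_sub, smul_zsmul_geomPoints]

/-- `d • (k • Q)` is fixed when `(k * d) • Q` is. [folklore] -/
theorem zsmul_zsmul_mem_fixedPoints (k d : ℤ) {Q : geomPoints W}
    (hQ : (k * d) • Q ∈ MulAction.fixedPoints (absoluteGaloisGroup K) (geomPoints W)) :
    d • (k • Q) ∈ MulAction.fixedPoints (absoluteGaloisGroup K) (geomPoints W) := by
  rw [smul_smul, mul_comm]; exact hQ

variable {E} [CharZero K] [W.IsElliptic]

omit [CharZero K] [W.IsElliptic] in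
/-- `E(K̄_E)[d] ≤ E(K̄_E)[N]` for `d ∣ N`. [folklore] -/
theorem mem_torsionBy_localPoints_of_dvd {d N : ℤ} (h : d ∣ N) {T : localPoints W E}
    (hT : T ∈ AddSubgroup.torsionBy (localPoints W E) d) :
    T ∈ AddSubgroup.torsionBy (localPoints W E) N := by
  obtain ⟨e, rfl⟩ := h
  change (d * e) • T = 0
  have hT' : d • T = 0 := hT
  rw [mul_comm, mul_zsmul, hT', zsmul_zero]

/-- Compatibility of the torsion comparison with the inclusions `E[d] ↪ E[N]`:
`θ_N⁻¹ (T) = ι (θ_d⁻¹ T)` for `T ∈ E(K̄_E)[d]`. [folklore] -/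
theorem torsionPointsEquiv_symm_inclusion {d N : ℤ} (h : d ∣ N) (hd : d ≠ 0) (hN : N ≠ 0)
    (T : AddSubgroup.torsionBy (localPoints W E) d) :
    (W.torsionPointsEquiv N (E := E) hN).symm
        ⟨T, W.mem_torsionBy_localPoints_of_dvd h T.2⟩ =
      W.torsionInclusion h ((W.torsionPointsEquiv d (E := E) hd).symm T) := by
  apply (W.torsionPointsEquiv N (E := E) hN).injective
  apply Subtype.ext
  rw [AddEquiv.apply_symm_apply, coe_torsionPointsEquiv_apply]
  change (T : localPoints W E) =
    pointsMap W E (((W.torsionPointsEquiv d (E := E) hd).symm T : geomTorsion W d) : geomPoints W)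
  rw [pointsMap_torsionPointsEquiv_symm]

/-- **Local Kummer classes under `E[d] ↪ E[N]`** (`d ∣ N`): `ι_* κ_{E,d}(Q) = κ_{E,N}(Q)` for
`Q ∈ E(K̄_E)` with `d • Q ∈ E(E)` (same cocycle `σ ↦ σ • Q - Q`). Milne, *ADT*, I.§6, proof of
Prop. 6.9; Silverman, *AEC*, VIII.§2. [folklore] -/
theorem map_torsionInclusion_localKummerClass {d N : ℤ} (h : d ∣ N) (hd : d ≠ 0) (hN : N ≠ 0)
    (Q : localPoints W E)
    (hQ : d • Q ∈ MulAction.fixedPoints (absoluteGaloisGroup E) (localPoints W E))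
    (hQ' : N • Q ∈ MulAction.fixedPoints (absoluteGaloisGroup E) (localPoints W E)) :
    galoisCohomology.map ((W.torsionInclusion h).restrictField E) 1
        (W.localKummerClass d hd Q hQ) = W.localKummerClass N hN Q hQ' := by
  unfold localKummerClass
  rw [galoisCohomology.map_one_oneCocycleClass]
  congr 1
  apply Subtype.ext
  ext σ : 1
  exact (W.torsionPointsEquiv_symm_inclusion h hd hN ⟨σ • Q - Q, _⟩).symm

omit [CharZero K] [W.IsElliptic] in
/-- `k • T ∈ E(K̄_E)[d]` for `T ∈ E(K̄_E)[kd]`. [folklore] -/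
theorem zsmul_mem_torsionBy_localPoints (k d : ℤ) {T : localPoints W E}
    (hT : T ∈ AddSubgroup.torsionBy (localPoints W E) (k * d)) :
    k • T ∈ AddSubgroup.torsionBy (localPoints W E) d := by
  change d • (k • T) = 0
  have hT' : (k * d) • T = 0 := hT
  rw [smul_smul, mul_comm, hT']

/-- Compatibility of the torsion comparison with `[k] : E[kd] → E[d]`:
`θ_d⁻¹ (k • T) = k • θ_{kd}⁻¹ T` for `T ∈ E(K̄_E)[kd]`. [folklore] -/
theorem torsionPointsEquiv_symm_zsmul (k d : ℤ) (hkd : k * d ≠ 0) (hd : d ≠ 0)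
    (T : AddSubgroup.torsionBy (localPoints W E) (k * d)) :
    (W.torsionPointsEquiv d (E := E) hd).symm
        ⟨k • (T : localPoints W E), W.zsmul_mem_torsionBy_localPoints k d T.2⟩ =
      W.torsionMulBy k d ((W.torsionPointsEquiv (k * d) (E := E) hkd).symm T) := by
  apply (W.torsionPointsEquiv d (E := E) hd).injective
  apply Subtype.ext
  rw [AddEquiv.apply_symm_apply, coe_torsionPointsEquiv_apply, coe_torsionMulBy_apply, map_zsmul]
  change k • (T : localPoints W E) = k • pointsMap W E
    (((W.torsionPointsEquiv (k * d) (E := E) hkd).symm T : geomTorsion W (k * d)) : geomPoints W)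
  rw [pointsMap_torsionPointsEquiv_symm]

/-- **Local Kummer classes under `[k] : E[kd] → E[d]`**: `[k]_* κ_{E,kd}(Q) = κ_{E,d}(k • Q)` for
`Q ∈ E(K̄_E)` with `kd • Q ∈ E(E)` — the local Kummer class at level `kd` of a point `P ∈ E(K_v)`
maps to its local Kummer class at level `d` ("we can lift `b_v` to an element
`b_{v,1} ∈ H¹(G_v, A_{m²})` that is in the image of `A(K_v)`", Milne, *ADT*, I.§6, proof of
Prop. 6.9). Silverman, *AEC*, VIII.§2. [cite: MilneADT2006, Ch. I §6, proof of Prop. 6.9] -/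
theorem map_torsionMulBy_localKummerClass (k d : ℤ) (hkd : k * d ≠ 0) (hd : d ≠ 0)
    (Q : localPoints W E)
    (hQ : (k * d) • Q ∈ MulAction.fixedPoints (absoluteGaloisGroup E) (localPoints W E))
    (hQ' : d • (k • Q) ∈ MulAction.fixedPoints (absoluteGaloisGroup E) (localPoints W E)) :
    galoisCohomology.map ((W.torsionMulBy k d).restrictField E) 1
        (W.localKummerClass (k * d) hkd Q hQ) = W.localKummerClass d hd (k • Q) hQ' := by
  unfold localKummerClass
  rw [galoisCohomology.map_one_oneCocycleClass]
  congr 1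
  apply Subtype.ext
  ext σ : 1
  have h := (W.torsionPointsEquiv_symm_zsmul k d hkd hd
    ⟨σ • Q - Q, smul_sub_mem_torsionBy_localPoints hQ σ⟩).symm
  refine h.trans ?_
  change (W.torsionPointsEquiv d (E := E) hd).symm _ =
    (W.torsionPointsEquiv d (E := E) hd).symm ⟨σ • (k • Q) - k • Q, _⟩
  congr 1
  apply Subtype.ext
  change k • (σ • Q - Q) = σ • (k • Q) - k • Q
  rw [zsmul_sub, smul_zsmul_localPoints]

/-- Every local Kummer class at level `d` lifts along `[k]_*` to a local Kummer class at level
`kd` with the same underlying point of `E(E)`: for `Q` with `d • Q ∈ E(E)` and `k ≠ 0` there is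
`Q₁` with `k • Q₁ = Q` (divisibility of `E(K̄_E)`), and `[k]_* κ_{E,kd}(Q₁) = κ_{E,d}(Q)`. This is
the lift `b_v ↦ b_{v,1}` of Milne, *ADT*, I.§6, proof of Prop. 6.9.
[cite: MilneADT2006, Ch. I §6, proof of Prop. 6.9] -/
theorem exists_map_torsionMulBy_localKummerClass_eq (k d : ℤ) (hkd : k * d ≠ 0) (hd : d ≠ 0)
    (Q : localPoints W E)
    (hQ : d • Q ∈ MulAction.fixedPoints (absoluteGaloisGroup E) (localPoints W E)) :
    ∃ (Q₁ : localPoints W E)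
      (hQ₁ : (k * d) • Q₁ ∈ MulAction.fixedPoints (absoluteGaloisGroup E) (localPoints W E)),
      k • Q₁ = Q ∧
        galoisCohomology.map ((W.torsionMulBy k d).restrictField E) 1
          (W.localKummerClass (k * d) hkd Q₁ hQ₁) = W.localKummerClass d hd Q hQ := by
  have hk : k ≠ 0 := left_ne_zero_of_mul hkd
  obtain ⟨Q₁, hQ₁'⟩ : ∃ Q₁ : localPoints W E, k • Q₁ = Q :=
    (W.baseChange (AlgebraicClosure E)).zsmul_surjective_of_isAlgClosed hk Q
  have hfix : (k * d) • Q₁ ∈ MulAction.fixedPoints (absoluteGaloisGroup E) (localPoints W E) := by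
    rw [mul_comm, mul_zsmul, hQ₁']
    exact hQ
  refine ⟨Q₁, hfix, hQ₁', ?_⟩
  rw [W.map_torsionMulBy_localKummerClass k d hkd hd Q₁ hfix (by rw [hQ₁']; exact hQ)]
  exact localKummerClass_congr hQ₁'

end Levels

end WeierstrassCurve
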